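import Summits.ResolutionOfSingularities.ResolutionOfSingularities.Theorems.FrobeniusLadderFInjectiveMacaulayficationF108ClassRow
import Summits.ResolutionOfSingularities.ResolutionOfSingularities.Theorems.FrobeniusLadderFInjectiveMacaulayficationF108ToricBuild
import Summits.ResolutionOfSingularities.ResolutionOfSingularities.Theorems.FrobeniusLadderFInjectiveMacaulayficationF108ToricTables
import Summits.ResolutionOfSingularities.ResolutionOfSingularities.Theorems.FrobeniusLadderFInjectiveMacaulayficationF108ToricPoly

/-!
# [OURS · L1 W4.5a] ★ `F108Consumable_holds`: the open-obligation node `F108ClassRow.F108Consumable k n` holds for every field `k`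
# and every `n`

THE TORIC RESOLUTION OF THE NEWTON FAN OF A CONVENIENT POLYNOMIAL IN THE CONSUMER'S FAN-TABLE CURRENCY, proved in the kernel
(director SEAT-LIST RES 5 (R5)+(W-a), seat res-L1-toric-fan g0; files `…F108ToricCones/Star/StarSC/Stage/Build/MW/Tables/Poly`).
For `f ∈ k[X₀..X_{n−1}]` convenient, the exponent set `E = supp f ⊆ ℕⁿ` contains a pure power of every variable; `exists_inv_good_convenient`
gives a finite set `S` of decorated unimodular cones (a complete fan refining the Newton fan of `E` and the fan of `Bl₀ 𝔸ⁿ`, with a strictly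
concave support function and dual bases); the tables are `A = 𝔪·KA` of `…F108ToricTables`; the charts are the ray matrices; the Newton
refinement certificate `θ_c f = x^{V e₀}·g_c`, `g_c(0) = f_{e₀} ≠ 0` comes from the common minimiser `e₀` of the cone and the injectivity of a
unimodular matrix; the Rees cover certificate from the ray-shooting Minkowski–Weyl.  With this theorem the conditional class theorems of
`…F108ClassRow` (`fHalfRow_of_F108Consumable`, `pointFloorRow_of_F108Consumable`, …) hold with `hF := F108Consumable_holds k n`.
Sorry-free, standard axioms.  AI-written; weaker than expert review.  Resolution of singularities in positive characteristic is NOT proved by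
any of this.
-/

set_option linter.dupNamespace false

noncomputable section

namespace Summit.ResolutionOfSingularities.ResolutionOfSingularities.Theorems.FInjectiveMacaulayfication.F108Toric

open Matrix Finset MvPolynomial

variable {n : ℕ} {k : Type} [Field k]

/-- The case `n = 0` of `F108Consumable`: empty tables, no chart. -/
theorem f108_zero (f : MvPolynomial (Fin 0) k) :
    ∃ (A KA : Finset (Fin 0 →₀ ℕ)) (t : ℕ) (m : Fin t → (Fin 0 →₀ ℕ)) (V : Fin t → Matrix (Fin 0) (Fin 0) ℕ)
      (a : Fin t → Fin 0 → (Fin 0 →₀ ℕ)) (g : Fin t → MvPolynomial (Fin 0) k) (d : Fin t → (Fin 0 →₀ ℕ)),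
      Ideal.span ((fun e : Fin 0 →₀ ℕ => (monomial e (1 : k) : MvPolynomial (Fin 0) k)) '' (A : Set (Fin 0 →₀ ℕ))) =
        Ideal.span (Set.range fun j : Fin 0 => (X j : MvPolynomial (Fin 0) k)) *
          Ideal.span ((fun e : Fin 0 →₀ ℕ => (monomial e (1 : k) : MvPolynomial (Fin 0) k)) '' (KA : Set (Fin 0 →₀ ℕ))) ∧
      (∀ j : Fin 0, ∃ N : ℕ, Finsupp.single j N ∈ KA) ∧
      (∀ j ∈ (Finset.univ : Finset (Fin 0)), ∃ N : ℕ, Finsupp.single j N ∈ A) ∧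
      (∀ e ∈ A, ∃ j ∈ (Finset.univ : Finset (Fin 0)), 0 < e j) ∧
      (∀ e ∈ A, ∃ (c : Fin t) (K : ℕ), 1 ≤ K ∧ ∃ y ∈ (Ideal.span ((fun b : Fin 0 →₀ ℕ => (monomial b (1 : k) : MvPolynomial (Fin 0) k)) '' (A : Set (Fin 0 →₀ ℕ)))) ^ (K - 1),
        (monomial e (1 : k) : MvPolynomial (Fin 0) k) ^ K = monomial (m c) 1 * y) ∧
      (∀ c, IsUnit ((V c).map (Nat.cast : ℕ → ℤ)).det) ∧
      (∀ c i, a c i ∈ A) ∧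
      (∀ (c : Fin t) (i : Fin 0), (Finsupp.equivFunOnFinite.symm ((V c).mulVec ⇑(a c i)) : Fin 0 →₀ ℕ) =
        Finsupp.equivFunOnFinite.symm ((V c).mulVec ⇑(m c)) + Finsupp.single i 1) ∧
      (∀ (c : Fin t), ∀ e ∈ A, (Finsupp.equivFunOnFinite.symm ((V c).mulVec ⇑(m c)) : Fin 0 →₀ ℕ) ≤ Finsupp.equivFunOnFinite.symm ((V c).mulVec ⇑e)) ∧
      (∀ c, aeval (fun j : Fin 0 => ∏ i : Fin 0, (X i : MvPolynomial (Fin 0) k) ^ V c i j) f = monomial (d c) 1 * g c) ∧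
      (∀ c, constantCoeff (g c) ≠ 0) ∧
      (∀ c, m c ∈ A) := by
  refine ⟨∅, ∅, 0, Fin.elim0, Fin.elim0, Fin.elim0, Fin.elim0, Fin.elim0, ?_, fun j => j.elim0, fun j => j.elim0, by simp, by simp,
    fun c => c.elim0, fun c => c.elim0, fun c => c.elim0, fun c => c.elim0, fun c => c.elim0, fun c => c.elim0, fun c => c.elim0⟩
  simp

/-- ★ THE MAIN CASE `n ≥ 1` of `F108Consumable`. -/
theorem f108_pos (hn : 0 < n) (f : MvPolynomial (Fin n) k)
    (hconv : ∀ j : Fin n, ∃ N : ℕ, 0 < N ∧ MvPolynomial.coeff (Finsupp.single j N) f ≠ 0) :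
    ∃ (A KA : Finset (Fin n →₀ ℕ)) (t : ℕ) (m : Fin t → (Fin n →₀ ℕ)) (V : Fin t → Matrix (Fin n) (Fin n) ℕ)
      (a : Fin t → Fin n → (Fin n →₀ ℕ)) (g : Fin t → MvPolynomial (Fin n) k) (d : Fin t → (Fin n →₀ ℕ)),
      Ideal.span ((fun e : Fin n →₀ ℕ => (monomial e (1 : k) : MvPolynomial (Fin n) k)) '' (A : Set (Fin n →₀ ℕ))) =
        Ideal.span (Set.range fun j : Fin n => (X j : MvPolynomial (Fin n) k)) *
          Ideal.span ((fun e : Fin n →₀ ℕ => (monomial e (1 : k) : MvPolynomial (Fin n) k)) '' (KA : Set (Fin n →₀ ℕ))) ∧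
      (∀ j : Fin n, ∃ N : ℕ, Finsupp.single j N ∈ KA) ∧
      (∀ j ∈ (Finset.univ : Finset (Fin n)), ∃ N : ℕ, Finsupp.single j N ∈ A) ∧
      (∀ e ∈ A, ∃ j ∈ (Finset.univ : Finset (Fin n)), 0 < e j) ∧
      (∀ e ∈ A, ∃ (c : Fin t) (K : ℕ), 1 ≤ K ∧ ∃ y ∈ (Ideal.span ((fun b : Fin n →₀ ℕ => (monomial b (1 : k) : MvPolynomial (Fin n) k)) '' (A : Set (Fin n →₀ ℕ)))) ^ (K - 1),
        (monomial e (1 : k) : MvPolynomial (Fin n) k) ^ K = monomial (m c) 1 * y) ∧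
      (∀ c, IsUnit ((V c).map (Nat.cast : ℕ → ℤ)).det) ∧
      (∀ c i, a c i ∈ A) ∧
      (∀ (c : Fin t) (i : Fin n), (Finsupp.equivFunOnFinite.symm ((V c).mulVec ⇑(a c i)) : Fin n →₀ ℕ) =
        Finsupp.equivFunOnFinite.symm ((V c).mulVec ⇑(m c)) + Finsupp.single i 1) ∧
      (∀ (c : Fin t), ∀ e ∈ A, (Finsupp.equivFunOnFinite.symm ((V c).mulVec ⇑(m c)) : Fin n →₀ ℕ) ≤ Finsupp.equivFunOnFinite.symm ((V c).mulVec ⇑e)) ∧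
      (∀ c, aeval (fun j : Fin n => ∏ i : Fin n, (X i : MvPolynomial (Fin n) k) ^ V c i j) f = monomial (d c) 1 * g c) ∧
      (∀ c, constantCoeff (g c) ≠ 0) ∧
      (∀ c, m c ∈ A) := by
  classical
  -- the exponent set and its good state
  set E : Finset (Fin n → ℤ) := f.support.image ofN with hE
  have hEnn : ∀ e ∈ E, ∀ j, 0 ≤ e j := by
    intro e he j; obtain ⟨e', -, rfl⟩ := mem_image.1 he; exact ofN_nonneg e' j
  have hEconv : ∀ l : Fin n, ∃ c : ℤ, 0 < c ∧ c • (Pi.single l 1 : Fin n → ℤ) ∈ E := by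
    intro l; obtain ⟨N, hN, hcoeff⟩ := hconv l
    refine ⟨N, by exact_mod_cast hN, mem_image.2 ⟨Finsupp.single l N, mem_support_iff.2 hcoeff, ?_⟩⟩
    funext j; simp only [ofN, Finsupp.single_apply, Pi.smul_apply, Pi.single_apply, smul_eq_mul]
    by_cases h : j = l
    · subst h; simp
    · rw [if_neg (Ne.symm h), if_neg h]; simp
  obtain ⟨S, hS, hgood⟩ := exists_inv_good_convenient hn E hEnn hEconv
  -- enumeration of the charts
  set enum : Fin S.card → DCone n := fun c => (S.equivFin.symm c).1 with henum
  have henumS : ∀ c, enum c ∈ S := fun c => (S.equivFin.symm c).2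
  have hnn : ∀ c i j, 0 ≤ (enum c).ray i j := fun c => hS.nonneg _ (henumS c)
  -- common minimisers
  have hmin0 : ∀ c, ∃ e₀ ∈ f.support, ∀ i, ∀ e ∈ f.support, (enum c).ray i ⬝ᵥ ofN e₀ ≤ (enum c).ray i ⬝ᵥ ofN e := by
    intro c; obtain ⟨b, hb, hmin⟩ := hgood _ (henumS c)
    obtain ⟨e₀, he₀, rfl⟩ := mem_image.1 hb
    exact ⟨e₀, he₀, fun i e he => hmin i (ofN e) (mem_image_of_mem _ he)⟩
  choose e₀ he₀ hmin using hmin0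
  have hle : ∀ c, ∀ e ∈ f.support, (Finsupp.equivFunOnFinite.symm (natMat (enum c) *ᵥ ⇑(e₀ c)) : Fin n →₀ ℕ) ≤
      Finsupp.equivFunOnFinite.symm (natMat (enum c) *ᵥ ⇑e) := by
    intro c e he
    refine Finsupp.le_def.2 fun i => ?_
    simp only [Finsupp.coe_equivFunOnFinite_symm]
    have h := hmin c i e he
    rw [← cast_natMat_mulVec_ofN (hnn c), ← cast_natMat_mulVec_ofN (hnn c)] at h
    exact_mod_cast h
  -- the data
  refine ⟨(AA S).image toN, (KA S).image toN, S.card, fun c => toN (enum c).m, fun c => natMat (enum c),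
    fun c i => toN ((enum c).m + (enum c).w i),
    fun c => ∑ e ∈ f.support, monomial (Finsupp.equivFunOnFinite.symm (natMat (enum c) *ᵥ ⇑e) -
      Finsupp.equivFunOnFinite.symm (natMat (enum c) *ᵥ ⇑(e₀ c))) (coeff e f),
    fun c => Finsupp.equivFunOnFinite.symm (natMat (enum c) *ᵥ ⇑(e₀ c)), ?_, ?_, ?_, ?_, ?_, ?_, ?_, ?_, ?_, ?_, ?_, ?_⟩
  · -- hIA
    have hAset : ((AA S).image toN : Set (Fin n →₀ ℕ)) = {e | ∃ j, ∃ κ ∈ ((KA S).image toN : Set (Fin n →₀ ℕ)), e = Finsupp.single j 1 + κ} := by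
      ext e
      simp only [coe_image, Set.mem_image, mem_coe, Set.mem_setOf_eq]
      constructor
      · rintro ⟨e', he', rfl⟩
        obtain ⟨j, κ', hκ', rfl⟩ := mem_AA.1 he'
        refine ⟨j, toN κ', ⟨κ', hκ', rfl⟩, ?_⟩
        rw [toN_add (fun i => by rw [Pi.single_apply]; split_ifs <;> norm_num) (hS.KA_nonneg hκ'), toN_single]
      · rintro ⟨j, κ, ⟨κ', hκ', rfl⟩, rfl⟩
        refine ⟨Pi.single j 1 + κ', single_add_mem_AA j hκ', ?_⟩
        rw [toN_add (fun i => by rw [Pi.single_apply]; split_ifs <;> norm_num) (hS.KA_nonneg hκ'), toN_single]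
    rw [hAset]; exact span_image_single_add _
  · -- hKprim
    intro j
    exact ⟨(bigN S).toNat, mem_image.2 ⟨_, bigN_single_mem_KA j, toN_smul_single _ _⟩⟩
  · -- hprim
    intro j _
    refine ⟨(1 + bigN S).toNat, mem_image.2 ⟨_, succ_single_mem_AA j, ?_⟩⟩
    rw [show (Pi.single j 1 : Fin n → ℤ) + bigN S • Pi.single j 1 = (1 + bigN S) • Pi.single j 1 by rw [add_smul, one_smul],
      toN_smul_single]
  · -- hAJ
    intro e he
    obtain ⟨e', he', rfl⟩ := mem_image.1 he
    obtain ⟨j, hj⟩ := hS.AA_exists_pos he'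
    exact ⟨j, mem_univ j, by rw [toN_apply]; omega⟩
  · -- hcov
    intro e he
    obtain ⟨e', he', rfl⟩ := mem_image.1 he
    obtain ⟨d₀, hd₀, D, μ, hμ₀, hsum, hineq⟩ := hS.AA_cover he'
    have he'nn : ∀ j, 0 ≤ e' j := hS.AA_nonneg he'
    set I := Ideal.span ((fun b : Fin n →₀ ℕ => (monomial b (1 : k) : MvPolynomial (Fin n) k)) '' (((AA S).image toN : Finset _) : Set (Fin n →₀ ℕ))) with hI
    have hmemI : ∀ x ∈ AA S, (monomial (toN x) (1 : k) : MvPolynomial (Fin n) k) ∈ I :=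
      fun x hx => Ideal.subset_span ⟨toN x, mem_coe.2 (mem_image_of_mem toN hx), rfl⟩
    -- the remainder
    set r : Fin n → ℤ := fun j => (D : ℤ) * e' j - ∑ d ∈ S, (μ d : ℤ) * d.m j with hr
    have hrnn : ∀ j, 0 ≤ r j := fun j => by rw [hr]; dsimp only; linarith [hineq j]
    refine ⟨S.equivFin ⟨d₀, hd₀⟩, D + 1, by omega, ?_⟩
    have henum0 : enum (S.equivFin ⟨d₀, hd₀⟩) = d₀ := by rw [henum]; simp
    simp only [henum0, Nat.add_sub_cancel]
    refine ⟨monomial (toN r) 1 * (monomial (toN e') 1 * (monomial (toN d₀.m) 1 ^ (μ d₀ - 1) *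
      ∏ d ∈ S.erase d₀, monomial (toN d.m) 1 ^ μ d)), ?_, ?_⟩
    · -- membership in `I ^ D`
      refine Ideal.mul_mem_left _ _ ?_
      have h1 : (monomial (toN e') (1 : k) : MvPolynomial (Fin n) k) ∈ I ^ 1 := by rw [pow_one]; exact hmemI e' he'
      have h2 : (monomial (toN d₀.m) (1 : k) : MvPolynomial (Fin n) k) ^ (μ d₀ - 1) ∈ I ^ (μ d₀ - 1) :=
        Ideal.pow_mem_pow (hmemI _ (m_mem_AA hd₀)) _
      have h3 : ∏ d ∈ S.erase d₀, (monomial (toN d.m) (1 : k) : MvPolynomial (Fin n) k) ^ μ d ∈ I ^ (∑ d ∈ S.erase d₀, μ d) := by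
        rw [← prod_pow_eq_pow_sum]
        exact Ideal.prod_mem_prod fun d hd => Ideal.pow_mem_pow (hmemI _ (m_mem_AA (mem_of_mem_erase hd))) _
      have hD : 1 + (μ d₀ - 1) + ∑ d ∈ S.erase d₀, μ d = D := by
        rw [← hsum, ← add_sum_erase S μ hd₀]; omega
      rw [← hD, pow_add, pow_add, mul_assoc]
      exact Ideal.mul_mem_mul h1 (Ideal.mul_mem_mul h2 h3)
    · -- the exponent identity
      have hmnn : ∀ d ∈ S, ∀ j, 0 ≤ d.m j := fun d hd => hS.mnonneg d hd
      simp_rw [monomial_pow, one_pow]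
      rw [prod_monomial_one]
      simp only [monomial_mul, one_mul]
      congr 1
      congr 1
      apply Finsupp.ext; intro j
      have hsumS : ∑ d ∈ S, (μ d : ℤ) * d.m j = (μ d₀ : ℤ) * d₀.m j + ∑ d ∈ S.erase d₀, (μ d : ℤ) * d.m j :=
        (add_sum_erase S (fun d => (μ d : ℤ) * d.m j) hd₀).symm
      simp only [Finsupp.coe_add, Pi.add_apply, Finsupp.coe_smul, Pi.smul_apply, smul_eq_mul, Finsupp.finsetSum_apply]
      zify [hμ₀]
      rw [cast_toN he'nn, cast_toN (hmnn d₀ hd₀), cast_toN hrnn]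
      rw [sum_congr rfl fun d hd => by rw [cast_toN (hmnn d (mem_of_mem_erase hd))]]
      rw [hr]; dsimp only; rw [hsumS]; ring
  · -- hV
    intro c; rw [natMat_map_cast (hnn c)]; exact hS.isUnit_det (henumS c)
  · -- haA
    intro c i; exact mem_image_of_mem _ (hS.m_add_w_mem_AA (henumS c) i)
  · -- hgen
    intro c i
    apply Finsupp.ext; intro j
    simp only [Finsupp.coe_equivFunOnFinite_symm, Finsupp.coe_add, Pi.add_apply]
    have h := hS.ray_dot_m_add_w (henumS c) i j
    rw [← cast_natMat_mulVec_toN (hnn c) (x := (enum c).m + (enum c).w i) (fun j => hS.m_add_w_nonneg (henumS c) i j),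
      ← cast_natMat_mulVec_toN (hnn c) (x := (enum c).m) (hS.mnonneg _ (henumS c))] at h
    rw [Finsupp.single_apply]
    by_cases hij : i = j
    · subst hij; rw [if_pos rfl] at h ⊢; exact_mod_cast h
    · rw [if_neg hij] at h ⊢; exact_mod_cast h
  · -- hge
    intro c e he
    obtain ⟨e', he', rfl⟩ := mem_image.1 he
    refine Finsupp.le_def.2 fun i => ?_
    simp only [Finsupp.coe_equivFunOnFinite_symm]
    have h := hS.AA_ge he' (henumS c) i
    rw [← cast_natMat_mulVec_toN (hnn c) (hS.mnonneg _ (henumS c)), ← cast_natMat_mulVec_toN (hnn c) (hS.AA_nonneg he')] at h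
    exact_mod_cast h
  · -- hθ
    intro c
    conv_lhs => rw [f.as_sum]
    rw [map_sum, mul_sum]
    refine sum_congr rfl fun e he => ?_
    rw [aeval_monomial_natMat, monomial_mul, one_mul, add_tsub_cancel_of_le (hle c e he)]
  · -- hg0
    intro c
    rw [map_sum]
    simp_rw [constantCoeff_monomial]
    rw [sum_eq_single (e₀ c)]
    · rw [if_pos (tsub_self _)]; exact mem_support_iff.1 (he₀ c)
    · intro e he hne
      rw [if_neg]
      intro h0
      apply hne
      have hle' := hle c e he
      have hge' : (Finsupp.equivFunOnFinite.symm (natMat (enum c) *ᵥ ⇑e) : Fin n →₀ ℕ) ≤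
          Finsupp.equivFunOnFinite.symm (natMat (enum c) *ᵥ ⇑(e₀ c)) := tsub_eq_zero_iff_le.1 h0
      have heq : natMat (enum c) *ᵥ ⇑e = natMat (enum c) *ᵥ ⇑(e₀ c) := by
        have := le_antisymm hge' hle'
        funext i; have := congrArg (fun v => v i) this; simpa using this
      -- the ray matrix is injective
      have hz : (Matrix.of (enum c).ray) *ᵥ ofN e = (Matrix.of (enum c).ray) *ᵥ ofN (e₀ c) := by
        funext i
        have h1 := cast_natMat_mulVec_ofN (hnn c) e i
        have h2 := cast_natMat_mulVec_ofN (hnn c) (e₀ c) i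
        rw [heq] at h1
        have h3 : (enum c).ray i ⬝ᵥ ofN e = (enum c).ray i ⬝ᵥ ofN (e₀ c) := h1.symm.trans h2
        exact h3
      have := hS.mulVec_injective (henumS c) hz
      ext i
      have h4 : ((e i : ℕ) : ℤ) = ((e₀ c i : ℕ) : ℤ) := congrFun this i
      exact_mod_cast h4
    · intro h; exact absurd (he₀ c) h
  · -- hm
    intro c; exact mem_image_of_mem _ (m_mem_AA (henumS c))

end Summit.ResolutionOfSingularities.ResolutionOfSingularities.Theorems.FInjectiveMacaulayfication.F108Toric

namespace Summit.ResolutionOfSingularities.ResolutionOfSingularities.Theorems.FInjectiveMacaulayfication.F108ClassRow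

/-- ★★★ **`F108Consumable k n` HOLDS for every field `k` and every `n`** (toric resolution of the Newton fan of a convenient polynomial,
in the fan-table currency of the consumer ✓ p656605): the OURS open-obligation node of `…F108ClassRow` is discharged in the kernel, so
`affineBlowup_fullCl_of_F108Consumable`, `fHalfRow_of_F108Consumable`, `pointFloorRow_of_F108Consumable`,
`pointFloorRow_of_F108Consumable_of_ringEquiv` hold with `hF := F108Consumable_holds k n`. [OURS · kernel theorem; no Literature fact used] -/
theorem F108Consumable_holds (k : Type) [Field k] (n : ℕ) : F108Consumable k n := by
  intro f hconv
  rcases Nat.eq_zero_or_pos n with hn | hn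
  · subst hn; exact F108Toric.f108_zero f
  · exact F108Toric.f108_pos hn f hconv

end Summit.ResolutionOfSingularities.ResolutionOfSingularities.Theorems.FInjectiveMacaulayfication.F108ClassRow



end
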